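import Literature.NumberTheory.EllipticCurves.Iwasawa
import HarnessLib

/-!
# BSD family: discharges for the Iwasawa-theoretic package (**bsd.S22**, proofs file)

Sibling proofs file of `Literature/NumberTheory/EllipticCurves/Iwasawa.lean` (D-0014: the named
facts there stay `def X : Prop`; users' hypotheses `(h : X)` are fed `X_holds` from here).

## Main result

* `Literature.BSD.mu_lambda_wellDefined_holds : mu_lambda_wellDefined p M` — pseudo-isomorphic
  (finitely generated torsion) `Λ`-modules have the same `μ`- and the same `λ`-invariant
  (Washington, *Introduction to Cyclotomic Fields*, §13.2, discussion after Thm. 13.12: the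
  invariants `μ = ∑ μᵢ`, `λ = ∑ nⱼ deg fⱼ` of `M ∼ ⨁ Λ/(p^{μᵢ}) ⊕ ⨁ Λ/(fⱼ^{nⱼ})` depend only
  on `M`).

## Architecture of the proof (Mathlib-only, for the intrinsic H21 definitions of `μ` and `λ`)

Let `f : M →ₗ[Λ] N` have pseudo-null kernel and cokernel (`Literature.NumberTheory.EllipticCurves.LinearMap.IsPseudoIsomorphism`).

* `μ` (`Literature.muInvariant p M` = local length of `M` at the prime `(p) = augIdealP p`):
  localisation of modules is exact, so at any prime `𝔭` of height `≤ 1` the localised map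
  `M_𝔭 → N_𝔭` is injective (kernel commutes with localisation and `(ker f)_𝔭 = 0`) and surjective
  (`LinearMap.localizedMap_surjective_iff_subsingleton_localized_coker` and `(coker f)_𝔭 = 0`),
  hence an `Λ_𝔭`-linear isomorphism and `length M_𝔭 = length N_𝔭`
  (`Literature.NumberTheory.EllipticCurves.LinearMap.IsPseudoIsomorphism.lengthAt_eq`).  The prime `(p)` is principal and generated
  by a non-unit, so it has height `≤ 1` by Krull's Hauptidealsatz
  (`Ideal.height_span_singleton_le_one`).  This is the localisation description of
  pseudo-isomorphisms (Bourbaki, *Algèbre commutative* VII §4.4) specialised to `Λ`.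
* `λ` (`Literature.lambdaInvariant p M = dim_{ℚₚ} (ℚₚ ⊗_{ℤₚ} M)`, the description of `λ` printed in
  Greenberg, LNM 1716, §1: "`λ = dim_{ℚ_p}(X ⊗_{ℤ_p} ℚ_p)`"): `dim Λ = 2`, so pseudo-null
  `Λ`-modules are `p`-power torsion elementwise (`Literature.NumberTheory.EllipticCurves.exists_C_p_pow_smul_eq_zero_of_isPseudoNull`),
  and base change to the flat `ℤₚ`-algebra `ℚₚ`, in which `p` is a unit, turns `f` into a
  bijection (`Literature.NumberTheory.EllipticCurves.Module.finrank_baseChange_eq_of_pow_smul`).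

Neither half uses the finiteness or torsion hypotheses of `mu_lambda_wellDefined`; the theorem is
proved for arbitrary `Λ`-modules (`muInvariant_eq_of_isPseudoIsomorphism`,
`lambdaInvariant_eq_of_isPseudoIsomorphism`) and then specialised.

Also discharged here (one-liners onto already-proved prelude results):
`Literature.NumberTheory.EllipticCurves.charIdeal_isPrincipal'_holds` (`Literature.NumberTheory.EllipticCurves.charIdeal_isPrincipal_holds`) and
`Literature.NumberTheory.EllipticCurves.finrank_layer'_holds` (`Literature.NumberTheory.EllipticCurves.ZpExtension.finrank_layer_holds`; number fields are perfect).

## References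

* L. C. Washington, *Introduction to Cyclotomic Fields*, 2nd ed., GTM 83 (1997), §13.1–13.2
  (Thm. 13.12 and the discussion following it) — `Washington1997`.
* R. Greenberg, *Iwasawa theory for elliptic curves*, LNM 1716 (1999), §1 — `GreenbergLNM1716`.
* S. Lang, *Cyclotomic Fields I and II*, GTM 121 (1990), Ch. 5 §§1–3 (quasi-isomorphisms,
  structure theorem Thm. 3.1) — `Lang1990`.
* N. Bourbaki, *Algèbre commutative*, Ch. VII §4.4 (pseudo-isomorphisms via localisation at
  primes of height `≤ 1`).
-/

noncomputable section

open scoped TensorProduct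

universe u

namespace Literature.NumberTheory.EllipticCurves

/-! ### Generic commutative algebra: pseudo-isomorphisms localise to isomorphisms in height `≤ 1` -/

namespace LinearMap

variable {R : Type*} [CommRing R] {M N : Type*} [AddCommGroup M] [_root_.Module R M]
  [AddCommGroup N] [_root_.Module R N]

/-- If the localisation `(ker f)_S` vanishes, then the localised map `S⁻¹f : M_S → N_S` is
injective (localisation of modules is exact: the kernel of `S⁻¹f` is the localisation of
`ker f`). [folklore] -/
theorem injective_localizedMap_of_subsingleton_localized_ker (S : Submonoid R) (f : M →ₗ[R] N)
    (h : Subsingleton (LocalizedModule S (LinearMap.ker f))) :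
    Function.Injective (LocalizedModule.map S f) := by
  rw [LocalizedModule.subsingleton_iff] at h
  rw [← LinearMap.ker_eq_bot, eq_bot_iff]
  intro x hx
  induction x using LocalizedModule.induction_on with
  | h m s =>
    rw [LinearMap.mem_ker, LocalizedModule.map_mk, ← LocalizedModule.zero_mk s,
      LocalizedModule.mk_eq] at hx
    obtain ⟨u, hu⟩ := hx
    simp only [smul_zero, Submonoid.smul_def, ← map_smul] at hu
    obtain ⟨r, hr, hrm⟩ := h ⟨_, hu⟩
    have hrm' := congrArg Subtype.val hrm
    simp only [SetLike.val_smul, ZeroMemClass.coe_zero] at hrm'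
    rw [Submodule.mem_bot, ← LocalizedModule.zero_mk s, LocalizedModule.mk_eq]
    refine ⟨⟨r, hr⟩ * u, ?_⟩
    simp only [smul_zero, Submonoid.smul_def, mul_smul]
    exact hrm'

/-- A pseudo-isomorphism `f : M → N` (pseudo-null kernel and cokernel) becomes bijective after
localising at any prime `𝔭` of height `≤ 1`: `M_𝔭 ≃ N_𝔭` (Bourbaki, *Algèbre commutative*
VII §4.4; over `Λ`: Washington §13.2). [folklore] -/
theorem IsPseudoIsomorphism.bijective_localizedMap {f : M →ₗ[R] N}
    (hf : LinearMap.IsPseudoIsomorphism f) (𝔭 : PrimeSpectrum R) (h𝔭 : 𝔭.asIdeal.height ≤ 1) :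
    Function.Bijective (LocalizedModule.map 𝔭.asIdeal.primeCompl f) :=
  ⟨injective_localizedMap_of_subsingleton_localized_ker _ f (hf.1 𝔭 h𝔭),
    (LinearMap.localizedMap_surjective_iff_subsingleton_localized_coker _ f).2 (hf.2 𝔭 h𝔭)⟩

/-- Pseudo-isomorphic modules have the same local length at every prime of height `≤ 1`
(so, over a Noetherian normal domain, the same characteristic ideal; Bourbaki, *Algèbre
commutative* VII §4.4–4.5; over `Λ`: Washington §13.2). [folklore] -/
theorem IsPseudoIsomorphism.lengthAt_eq {f : M →ₗ[R] N}
    (hf : LinearMap.IsPseudoIsomorphism f) (𝔭 : PrimeSpectrum R) (h𝔭 : 𝔭.asIdeal.height ≤ 1) :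
    Module.lengthAt R M 𝔭 = Module.lengthAt R N 𝔭 :=
  (LinearEquiv.ofBijective _ (hf.bijective_localizedMap 𝔭 h𝔭)).length_eq

end LinearMap

/-! ### The invariants `μ` and `λ` under pseudo-isomorphism -/

section BSD

section IwasawaAlgebra

open IwasawaAlgebra

variable (p : ℕ) [Fact p.Prime]

/-- The prime `(p) ⊂ Λ = ℤ_[p]⟦T⟧` has height `≤ 1`: it is principal, generated by the non-unit
constant power series `p` (Krull's Hauptidealsatz, `Ideal.height_span_singleton_le_one`).
(Its height is exactly `1`, Washington §13.2; only `≤ 1` is needed here.) [folklore] -/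
theorem height_augIdealP_le_one : (augIdealP p).height ≤ 1 := by
  refine Ideal.height_span_singleton_le_one fun h => PadicInt.p_nonunit (p := p) ?_
  simpa using (PowerSeries.isUnit_iff_constantCoeff (φ := PowerSeries.C (p : ℤ_[p]))).1 h

variable {M N : Type*} [AddCommGroup M] [Module (IwasawaAlgebra p) M]
  [AddCommGroup N] [Module (IwasawaAlgebra p) N]

/-- **`μ` is a pseudo-isomorphism invariant.** If `f : M → N` is a pseudo-isomorphism of
`Λ`-modules then `μ(M) = μ(N)`: `μ` is the local length at the height-one prime `(p)`, and `f`
localises to an isomorphism `M_{(p)} ≃ N_{(p)}`. (Washington, *Introduction to Cyclotomic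
Fields*, §13.2, discussion after Thm. 13.12: `μ = ∑ μᵢ` is well defined.)
[cite: Washington1997, §13.2 (discussion after Thm. 13.12)] -/
theorem muInvariant_eq_of_isPseudoIsomorphism {f : M →ₗ[IwasawaAlgebra p] N}
    (hf : LinearMap.IsPseudoIsomorphism f) : muInvariant p M = muInvariant p N := by
  unfold muInvariant
  refine finsum_mem_congr rfl fun 𝔭 h𝔭 => ?_
  rw [hf.lengthAt_eq 𝔭 (h𝔭 ▸ height_augIdealP_le_one p)]

/-- **`λ` is a pseudo-isomorphism invariant.** If `f : M → N` is a pseudo-isomorphism of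
`Λ`-modules then `λ(M) = λ(N)`, where `λ(M) = dim_{ℚₚ}(ℚₚ ⊗_{ℤₚ} M)` (Greenberg, LNM 1716, §1):
pseudo-null `Λ`-modules are `p`-power torsion elementwise (`dim Λ = 2`), and base change to the
flat `ℤₚ`-algebra `ℚₚ`, where `p` is invertible, makes `f` bijective. (Washington,
*Introduction to Cyclotomic Fields*, §13.2, discussion after Thm. 13.12: `λ = ∑ nⱼ deg fⱼ` is well
defined.) [cite: Washington1997, §13.2 (discussion after Thm. 13.12)]
[cite: GreenbergLNM1716, §1 (λ = dim ℚ_p X ⊗ ℚ_p)] -/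
theorem lambdaInvariant_eq_of_isPseudoIsomorphism {f : M →ₗ[IwasawaAlgebra p] N}
    (hf : LinearMap.IsPseudoIsomorphism f) : lambdaInvariant p M = lambdaInvariant p N := by
  obtain ⟨hker, hcoker⟩ := hf
  haveI : Module.Flat ℤ_[p] ℚ_[p] := IsLocalization.flat ℚ_[p] (nonZeroDivisors ℤ_[p])
  -- the `ℤₚ`-structures of `M`, `N` (definitionally those of `RestrictScalars ℤₚ Λ _`)
  letI : Module ℤ_[p] M := Module.compHom M (algebraMap ℤ_[p] (IwasawaAlgebra p))
  haveI : IsScalarTower ℤ_[p] (IwasawaAlgebra p) M := IsScalarTower.of_compHom _ _ _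
  letI : Module ℤ_[p] N := Module.compHom N (algebraMap ℤ_[p] (IwasawaAlgebra p))
  haveI : IsScalarTower ℤ_[p] (IwasawaAlgebra p) N := IsScalarTower.of_compHom _ _ _
  -- kernel: `p`-power torsion
  have hker' : ∀ x : M, f.restrictScalars ℤ_[p] x = 0 → ∃ n : ℕ, (p : ℤ_[p]) ^ n • x = 0 := by
    intro x hx
    obtain ⟨n, hn⟩ := exists_C_p_pow_smul_eq_zero_of_isPseudoNull p hker ⟨x, hx⟩
    refine ⟨n, ?_⟩
    have hn' := congrArg Subtype.val hn
    simp only [SetLike.val_smul, ZeroMemClass.coe_zero] at hn'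
    rw [algebraMap_p_pow_smul p n x]
    exact hn'
  -- cokernel: `p`-power torsion
  have hcoker' : ∀ y : N, ∃ (n : ℕ) (x : M),
      (p : ℤ_[p]) ^ n • y = f.restrictScalars ℤ_[p] x := by
    intro y
    obtain ⟨n, hn⟩ := exists_C_p_pow_smul_eq_zero_of_isPseudoNull p hcoker
      (Submodule.Quotient.mk y)
    rw [← Submodule.Quotient.mk_smul, Submodule.Quotient.mk_eq_zero, LinearMap.mem_range] at hn
    obtain ⟨x, hx⟩ := hn
    refine ⟨n, x, ?_⟩
    rw [LinearMap.restrictScalars_apply, hx]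
    exact algebraMap_p_pow_smul p n y
  -- `lambdaInvariant p _` unfolds to
  -- `finrank ℚ_[p] (ℚ_[p] ⊗[ℤ_[p]] RestrictScalars ℤ_[p] Λ _)`, and the `ℤₚ`-structure of
  -- `RestrictScalars` is definitionally the `compHom` structure above
  have key := Module.finrank_baseChange_eq_of_pow_smul ℚ_[p] (isUnit_algebraMap_p p)
    (f.restrictScalars ℤ_[p]) hker' hcoker'
  exact key

/-- **bsd.S22 — discharge of `mu_lambda_wellDefined`.** Pseudo-isomorphic finitely generated
torsion `Λ`-modules have the same `μ`-invariant and the same `λ`-invariant, so `μ(M) = ∑ μᵢ` and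
`λ(M) = ∑ nⱼ deg fⱼ` do not depend on the elementary module chosen in the structure theorem
(Washington, *Introduction to Cyclotomic Fields*, §13.2, discussion after Thm. 13.12).  Proof:
`muInvariant_eq_of_isPseudoIsomorphism` (localisation at `(p)`) and
`lambdaInvariant_eq_of_isPseudoIsomorphism` (flat base change to `ℚₚ`); the finiteness and torsion
hypotheses are not needed. [cite: Washington1997, §13.2 (discussion after Thm. 13.12)] -/
theorem mu_lambda_wellDefined_holds (M : Type*) [AddCommGroup M] [Module (IwasawaAlgebra p) M] :
    mu_lambda_wellDefined p M := by
  intro N _ _ _ _ _ _ h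
  obtain ⟨f, hf⟩ := h
  exact ⟨muInvariant_eq_of_isPseudoIsomorphism p hf, lambdaInvariant_eq_of_isPseudoIsomorphism p hf⟩

/-- **bsd.S22 — discharge of `charIdeal_isPrincipal'`.** The characteristic ideal of a `Λ`-module
is principal (`Λ` is a UFD, so height-one primes are principal): the prelude discharge
`Literature.NumberTheory.EllipticCurves.charIdeal_isPrincipal_holds` (Washington, *Introduction to Cyclotomic Fields*, §13.2).
[cite: Washington1997, §13.2] -/
theorem charIdeal_isPrincipal'_holds (M : Type*) [AddCommGroup M] [Module (IwasawaAlgebra p) M] :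
    charIdeal_isPrincipal' p M :=
  charIdeal_isPrincipal_holds p M

end IwasawaAlgebra

section ZpExtension

variable (K : Type u) [Field K] [NumberField K] (p : ℕ) [Fact p.Prime]

/-- **bsd.S22 — discharge of `finrank_layer'`.** The `n`-th layer of a `ℤ_p`-extension of a
number field has degree `[K_n : K] = pⁿ`: the prelude discharge
`Literature.NumberTheory.EllipticCurves.ZpExtension.finrank_layer_holds` (for perfect fields; number fields have characteristic zero,
hence are perfect, `PerfectField.ofCharZero`) (Washington, *Introduction to Cyclotomic Fields*,
§13.1).
[cite: Washington1997, §13.1] -/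
theorem finrank_layer'_holds : finrank_layer' K p :=
  fun κ n => κ.finrank_layer_holds n

end ZpExtension

end BSD

end Literature.NumberTheory.EllipticCurves
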